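import Mathlib
import Summits.Ventures.PercRepro2.K5TypedSimple
import Summits.Ventures.PercRepro2.K5K3Transfer
import Summits.Ventures.PercRepro2.Inst8TypedK3

/-!
# Typed bases transfer along an embedding into an instance graph
(blind cell PercRepro2, typer-1 g14)

An `Embed G ends₀` is an embedding of a finite graph `ends₀ : E → Sym2 V` into the instance graph `G`:
an injective vertex map `ν`, an injective edge map `ι` with `ends G (ι e) = (ends₀ e).map ν`, and every
edge of `G` off the image of `ι` avoids the image of `ν`.  A configuration `x` of `ends₀` extends to the
configuration `ext φ x` of `G` (open exactly on the images of the open edges), and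

* **`conn_ext_iff`**: `Conn (ends G) (ext φ x) (ν u) (ν v) ↔ Conn ends₀ x u v` (both directions by the
  closure lemma `mem_of_conn_of_closed`);
* **`K3_ext`**: p1's kernel `K₃` of `ends₀` at a triple is `K₃` of `G` at the extended triple;
* **`typedCount_ext_eq`**: a typed count of `(F, z, τ)` on `ends₀` is the typed count of `(ι F, ext z, τ')`
  on `G` (the typed triples correspond bijectively along `ext`);
* **`typedBases_of_embed`** / **`typedBases_of_cert_embed`**: `CovForm.TypedBases` on `G` (a kernel
  certificate `Cert3 G b`) gives `CovForm.TypedBases ends₀ o a₁ a₂ a₃ b` for every graph embedded in `G` —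
  in particular the literal statements for the padded named objects (`S4NamedLiteral.lean`).
-/

namespace Summit.Ventures.PercRepro2

namespace Inst8

section Embed

variable {V : Type*} {E : Type*} [Fintype E] [DecidableEq E]

/-- An embedding of the finite graph `ends₀` into the instance graph `G`. -/
structure Embed (G : Inst) (ends₀ : E → Sym2 V) where
  /-- The vertex map. -/
  ν : V → Fin 8
  /-- The edge map. -/
  ι : E → Fin 10
  /-- The vertex map is injective. -/
  ν_inj : Function.Injective ν
  /-- The edge map is injective. -/
  ι_inj : Function.Injective ι
  /-- Edges map to edges. -/
  ends_eq : ∀ e, ends G (ι e) = (ends₀ e).map ν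
  /-- An edge of `G` off the image avoids the image of the vertex map. -/
  off : ∀ j, (∀ e, ι e ≠ j) → ∀ v ∈ ends G j, ∀ u, ν u ≠ v

variable {G : Inst} {ends₀ : E → Sym2 V} (φ : Embed G ends₀)

/-- The extension of a configuration along the embedding: open exactly on the images of open edges. -/
def ext (x : Config E) : Config (Fin 10) := fun j => decide (∃ e, φ.ι e = j ∧ x e = true)

omit [DecidableEq E] in
/-- The extension on an image edge. -/
lemma ext_ι (x : Config E) (e : E) : ext φ x (φ.ι e) = x e := by
  rw [Bool.eq_iff_iff]
  unfold ext
  rw [decide_eq_true_iff]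
  constructor
  · rintro ⟨e', he', hx⟩
    rwa [φ.ι_inj he'] at hx
  · intro hx
    exact ⟨e, rfl, hx⟩

omit [DecidableEq E] in
/-- The extension is closed off the image. -/
lemma ext_off (x : Config E) {j : Fin 10} (hj : ∀ e, φ.ι e ≠ j) : ext φ x j = false := by
  unfold ext
  rw [decide_eq_false_iff_not]
  rintro ⟨e, he, -⟩
  exact hj e he

omit [DecidableEq E] in
/-- The extension is injective. -/
lemma ext_injective : Function.Injective (ext φ) := by
  intro x y h
  funext e
  rw [← ext_ι φ x e, ← ext_ι φ y e, h]

omit [DecidableEq E] in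
/-- A configuration of `G` closed off the image is an extension. -/
lemma exists_ext_of_closed (x' : Config (Fin 10)) (h : ∀ j, (∀ e, φ.ι e ≠ j) → x' j = false) :
    ∃ x : Config E, ext φ x = x' := by
  refine ⟨fun e => x' (φ.ι e), ?_⟩
  funext j
  by_cases hj : ∃ e, φ.ι e = j
  · obtain ⟨e, rfl⟩ := hj
    rw [ext_ι]
  · rw [not_exists] at hj
    rw [ext_off φ _ hj, h j hj]

/-! ## Connectivity along the embedding -/

omit [DecidableEq E] in
/-- Open adjacency between image vertices corresponds. -/
lemma openAdj_ext_iff (x : Config E) (u v : V) :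
    OpenAdj (ends G) (ext φ x) (φ.ν u) (φ.ν v) ↔ OpenAdj ends₀ x u v := by
  constructor
  · rintro ⟨j, hj, hends⟩
    unfold ext at hj
    rw [decide_eq_true_iff] at hj
    obtain ⟨e, rfl, hx⟩ := hj
    refine ⟨e, hx, ?_⟩
    rw [φ.ends_eq] at hends
    exact Sym2.map.injective φ.ν_inj (hends.trans (Sym2.map_mk φ.ν u v).symm)
  · rintro ⟨e, he, h⟩
    exact ⟨φ.ι e, by rw [ext_ι]; exact he, by rw [φ.ends_eq, h, Sym2.map_mk]⟩

omit [DecidableEq E] in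
/-- An open neighbour of an image vertex is an image vertex. -/
lemma openAdj_ext_range (x : Config E) (u : V) {y : Fin 8}
    (h : OpenAdj (ends G) (ext φ x) (φ.ν u) y) : ∃ v, φ.ν v = y := by
  obtain ⟨j, hj, hends⟩ := h
  unfold ext at hj
  rw [decide_eq_true_iff] at hj
  obtain ⟨e, rfl, -⟩ := hj
  rw [φ.ends_eq] at hends
  have hy : y ∈ (ends₀ e).map φ.ν := by rw [hends]; exact Sym2.mem_mk_right _ _
  rw [Sym2.mem_map] at hy
  obtain ⟨v, -, hv⟩ := hy
  exact ⟨v, hv⟩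

omit [DecidableEq E] in
/-- **Connectivity along the embedding.** -/
theorem conn_ext_iff (x : Config E) (u v : V) :
    Conn (ends G) (ext φ x) (φ.ν u) (φ.ν v) ↔ Conn ends₀ x u v := by
  constructor
  · intro h
    have hS : ∀ y ∈ {y : Fin 8 | ∃ w, φ.ν w = y ∧ Conn ends₀ x u w}, ∀ y',
        (openGraph (ends G) (ext φ x)).Adj y y' → y' ∈ {y : Fin 8 | ∃ w, φ.ν w = y ∧ Conn ends₀ x u w} := by
      rintro y ⟨w, rfl, hw⟩ y' hadj
      rw [openGraph_adj] at hadj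
      obtain ⟨w', rfl⟩ := openAdj_ext_range φ x w hadj.2
      refine ⟨w', rfl, hw.trans ?_⟩
      have hne : w ≠ w' := fun h => hadj.1 (by rw [h])
      exact (openGraph_adj.2 ⟨hne, (openAdj_ext_iff φ x w w').1 hadj.2⟩).reachable
    have := mem_of_conn_of_closed hS ⟨u, rfl, conn_refl ends₀ x u⟩ h
    obtain ⟨w, hw, hconn⟩ := this
    rwa [φ.ν_inj hw] at hconn
  · intro h
    have hS : ∀ w ∈ {w : V | Conn (ends G) (ext φ x) (φ.ν u) (φ.ν w)}, ∀ w',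
        (openGraph ends₀ x).Adj w w' → w' ∈ {w : V | Conn (ends G) (ext φ x) (φ.ν u) (φ.ν w)} := by
      intro w hw w' hadj
      rw [openGraph_adj] at hadj
      have hne : φ.ν w ≠ φ.ν w' := fun h => hadj.1 (φ.ν_inj h)
      exact hw.trans (openGraph_adj.2 ⟨hne, (openAdj_ext_iff φ x w w').2 hadj.2⟩).reachable
    exact mem_of_conn_of_closed hS (conn_refl (ends G) (ext φ x) (φ.ν u)) h

/-! ## The kernel `K₃` along the embedding -/

variable {R : Type*} [Field R]

omit [DecidableEq E] in
/-- The indicator of a connection event, along the embedding. -/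
lemma indicator_connEvent_ext (x : Config E) (u v : V) :
    (connEvent ends₀ u v).indicator (1 : Config E → R) x =
      (connEvent (ends G) (φ.ν u) (φ.ν v)).indicator (1 : Config (Fin 10) → R) (ext φ x) := by
  refine K5.indicator_eq_of_iff ?_
  rw [mem_connEvent, mem_connEvent, conn_ext_iff]

omit [DecidableEq E] in
/-- The indicator of `Q = {a₁ ↮ a₂}`, along the embedding. -/
lemma indicator_avoidAll_ext (x : Config E) (a₁ a₂ : V) :
    (avoidAll ends₀ a₂ {a₁}).indicator (1 : Config E → R) x =
      (avoidAll (ends G) (φ.ν a₂) {φ.ν a₁}).indicator (1 : Config (Fin 10) → R) (ext φ x) := by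
  refine K5.indicator_eq_of_iff ?_
  simp only [mem_avoidAll, Finset.mem_singleton, forall_eq, conn_ext_iff]

omit [DecidableEq E] in
/-- The indicator of `PD`, along the embedding. -/
lemma indicator_PDEvent_ext (x : Config E) (a₁ a₂ a₃ : V) :
    (PDEvent ends₀ a₁ a₂ a₃).indicator (1 : Config E → R) x =
      (PDEvent (ends G) (φ.ν a₁) (φ.ν a₂) (φ.ν a₃)).indicator (1 : Config (Fin 10) → R) (ext φ x) := by
  refine K5.indicator_eq_of_iff ?_
  simp only [PDEvent, Dtilde, UnionCluster.inU, Set.mem_inter_iff, Set.mem_compl_iff, Set.mem_union,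
    mem_connEvent, conn_ext_iff]

omit [DecidableEq E] in
/-- **The kernel `K₃` of `ends₀` is the kernel of `G` along the embedding.** -/
theorem K3_ext (o a₁ a₂ a₃ b : V) (x y w : Config E) :
    CovForm.K3 (R := R) ends₀ o a₁ a₂ a₃ b x y w =
      CovForm.K3 (R := R) (ends G) (φ.ν o) (φ.ν a₁) (φ.ν a₂) (φ.ν a₃) (φ.ν b)
        (ext φ x) (ext φ y) (ext φ w) := by
  unfold CovForm.K3 CovForm.sepKernel CovForm.f3 CovForm.f4 CovForm.f5 CovForm.f6 CovForm.f7
    CovForm.f10 CovForm.f11 CovForm.f12 CovForm.sigma CovForm.inU CovForm.iQ CovForm.iPD CovForm.iL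
    CovForm.iH
  simp only [Fin.sum_univ_succ, Fin.sum_univ_zero, Matrix.cons_val_zero, Matrix.cons_val_succ,
    add_zero, indicator_connEvent_ext φ, indicator_avoidAll_ext φ, indicator_PDEvent_ext φ]

/-! ## Typed counts along the embedding -/

/-- The type map transported along the edge map (zero off the image). -/
noncomputable def extτ (τ : E → ℕ) : Fin 10 → ℕ := Function.extend φ.ι τ 0

omit [Fintype E] [DecidableEq E] in
/-- The transported type map on an image edge. -/
lemma extτ_ι (τ : E → ℕ) (e : E) : extτ φ τ (φ.ι e) = τ e := φ.ι_inj.extend_apply τ 0 e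

omit [DecidableEq E] in
/-- Open counts along the embedding. -/
lemma openCount_ext (x y w : Config E) (e : E) :
    openCount (ext φ x) (ext φ y) (ext φ w) (φ.ι e) = openCount x y w e := by
  unfold openCount
  rw [ext_ι, ext_ι, ext_ι]

/-- **A typed count on `ends₀` is a typed count on `G`**, for any kernel pulled back along `ext`. -/
theorem typedCount_ext_eq (F : Finset E) (z : Config E) (τ : E → ℕ)
    (K : Config (Fin 10) → Config (Fin 10) → Config (Fin 10) → R) :
    typedCount F z τ (fun x y w => K (ext φ x) (ext φ y) (ext φ w)) =
      typedCount (F.map ⟨φ.ι, φ.ι_inj⟩) (ext φ z) (extτ φ τ) K := by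
  rw [K5.typedCount_eq_sum_triples, K5.typedCount_eq_sum_triples]
  refine K5.sum_ite_nbij _ _ _ _ (fun t => (ext φ t.1, ext φ t.2.1, ext φ t.2.2)) _ _ ?_ ?_ ?_ ?_
  · rintro ⟨x, y, w⟩ ⟨hz, hτ⟩
    refine ⟨fun j hj => ?_, fun j hj => ?_⟩
    · by_cases he : ∃ e, φ.ι e = j
      · obtain ⟨e, rfl⟩ := he
        have heF : e ∉ F := fun h => hj (Finset.mem_map_of_mem _ h)
        simp only [ext_ι]
        exact hz e heF
      · rw [not_exists] at he
        simp only [ext_off φ _ he, and_self]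
    · rw [Finset.mem_map] at hj
      obtain ⟨e, heF, rfl⟩ := hj
      simp only [Function.Embedding.coeFn_mk] at *
      rw [openCount_ext, extτ_ι]
      exact hτ e heF
  · rintro ⟨x, y, w⟩ ⟨x', y', w'⟩ - - h
    simp only [Prod.mk.injEq] at h
    obtain ⟨h1, h2, h3⟩ := h
    rw [ext_injective φ h1, ext_injective φ h2, ext_injective φ h3]
  · rintro ⟨x', y', w'⟩ ⟨hz, hτ⟩
    have hcl : ∀ (c : Config (Fin 10)), (∀ j, j ∉ F.map ⟨φ.ι, φ.ι_inj⟩ → c j = ext φ z j) →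
        ∀ j, (∀ e, φ.ι e ≠ j) → c j = false := by
      intro c hc j hj
      have hjF : j ∉ F.map ⟨φ.ι, φ.ι_inj⟩ := by
        rw [Finset.mem_map]
        rintro ⟨e, -, he⟩
        exact hj e he
      rw [hc j hjF, ext_off φ z hj]
    obtain ⟨x, rfl⟩ := exists_ext_of_closed φ x' (hcl x' fun j hj => (hz j hj).1)
    obtain ⟨y, rfl⟩ := exists_ext_of_closed φ y' (hcl y' fun j hj => (hz j hj).2.1)
    obtain ⟨w, rfl⟩ := exists_ext_of_closed φ w' (hcl w' fun j hj => (hz j hj).2.2)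
    refine ⟨(x, y, w), ⟨fun e he => ?_, fun e he => ?_⟩, rfl⟩
    · have hj : φ.ι e ∉ F.map ⟨φ.ι, φ.ι_inj⟩ := by
        rw [Finset.mem_map]
        rintro ⟨e', he', h⟩
        exact he (φ.ι_inj h ▸ he')
      have := hz (φ.ι e) hj
      simp only [ext_ι] at this
      exact this
    · have := hτ (φ.ι e) (Finset.mem_map_of_mem _ he)
      rwa [openCount_ext, extτ_ι] at this
  · rintro ⟨x, y, w⟩ -
    rfl

/-! ## The typed bases along the embedding -/

variable [LinearOrder R] [IsStrictOrderedRing R]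

omit [IsStrictOrderedRing R] in
/-- **Typed bases transfer along an embedding**: row 2′TRI on `G` (at the image marks) gives row 2′TRI on
`ends₀`. -/
theorem typedBases_of_embed (o a₁ a₂ a₃ b : V)
    (h : CovForm.TypedBases (R := R) (ends G) (φ.ν o) (φ.ν a₁) (φ.ν a₂) (φ.ν a₃) (φ.ν b)) :
    CovForm.TypedBases (R := R) ends₀ o a₁ a₂ a₃ b := by
  intro F z τ hτ
  have hK : CovForm.K3 (R := R) ends₀ o a₁ a₂ a₃ b = fun x y w =>
      CovForm.K3 (R := R) (ends G) (φ.ν o) (φ.ν a₁) (φ.ν a₂) (φ.ν a₃) (φ.ν b)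
        (ext φ x) (ext φ y) (ext φ w) := by
    funext x y w
    exact K3_ext φ o a₁ a₂ a₃ b x y w
  rw [hK, typedCount_ext_eq]
  refine h _ _ _ fun j hj => ?_
  rw [Finset.mem_map] at hj
  obtain ⟨e, he, rfl⟩ := hj
  simp only [Function.Embedding.coeFn_mk]
  rw [extτ_ι]
  exact hτ e he

/-- **Typed bases of an embedded graph from the kernel certificate of the instance** (marks at
`0, 1, 2, 3, b'`). -/
theorem typedBases_of_cert_embed (b' : Fin 8) (hc : Cert3 G b') (o a₁ a₂ a₃ b : V) (h0 : φ.ν o = 0)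
    (h1 : φ.ν a₁ = 1) (h2 : φ.ν a₂ = 2) (h3 : φ.ν a₃ = 3) (hb : φ.ν b = b') :
    CovForm.TypedBases (R := R) ends₀ o a₁ a₂ a₃ b := by
  refine typedBases_of_embed φ o a₁ a₂ a₃ b ?_
  rw [h0, h1, h2, h3, hb]
  exact typedBases_of_cert G b' hc

end Embed

end Inst8

end Summit.Ventures.PercRepro2
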